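import Mathlib
import Summits.Ventures.HodgeRepro2.Tier7.Line3.DiscreteSubgroupPacking

/-!
# Tier 7 — LINE 3 support: the sharp `κ`-count of EVERY discrete subgroup of `SL(2, ℝ)`
(`Line3/DiscreteSubgroupCount.lean`; t7-L1-p1, gen 3; Mathlib + Line3/DiscreteSubgroupPacking (+ Line3/HyperbolicSize) —
part 2 of 2, the count)

`Line3/ModularGroupCount.lean` (p676642) counts the elements of the MODULAR group `SL(2, ℤ)` in the cosh-size
`κ g = (a² + b² + c² + d²) / 2` of `Line3/HyperbolicSize.lean` with the sharp exponent `β = 1`, by the arithmetic of the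
integer entries. The real lattice of the line (`U(W_A)(F)` at a `(1,1)`-place, the dictionary's object) is NOT `SL(2, ℤ)`;
the only property of it that the Poincaré-series kernel uses is that it is DISCRETE in the real group. THIS FILE proves the
sharp count for EVERY discrete subgroup `Γ ≤ SL(2, ℝ)` — discreteness taken in its elementary form «`1` is isolated in
`Γ`»: `IsolatedOne Γ ε₀ := ∀ γ ∈ Γ, (∀ i j, |γ i j − δ i j| < ε₀) → γ = 1`, some `ε₀ > 0` (equivalent to `Γ` discrete in the
matrix topology, since `Γ` is a group) — with an explicit constant:
  `#{γ ∈ Γ : κ γ ≤ R} ≤ 512 R / ε³`, `ε = min (1/8) (ε₀/8)`   (`card_le_of_kappa_le`, `count_of_discrete`),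
so `HyperbolicSize.summable_norm_kernel_SL2` / `continuous_kernelSum_SL2` apply with `β = 1` to every discrete `Γ` and
every `f` with `‖f g‖ ≤ C (1 + κ g)^(−α)`, `α > 1` (`summable_norm_kernel_discrete`, `continuous_kernelSum_discrete`;
weight `k = 3`: `α = 3/2`). `SL(2, ℤ)` (its image `SL2Z ≤ SL(2, ℝ)`) is the instance `ε₀ = 1` (`isolated_one_SL2Z`,
`count_SL2Z_range`).

PROOF — packing in `M₂(ℝ) = ℝ⁴` with Lebesgue measure (the geometry is `Line3/DiscreteSubgroupPacking.lean`: the orthogonal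
coordinates `E = ℝ² × ℝ²` with `4 det = ‖p‖² − ‖q‖²`, `2 Σ Y² = ‖p‖² + ‖q‖²`, the measure-preserving action `actE γ`, the
ball `B = ball z₁ ε` around the identity, the explicit `2 × 2` inverse); no Haar measure on `SL(2, ℝ)`, no hyperbolic area:
* for `γ ≠ γ'` in `Γ` the translates `γ B`, `γ' B` are DISJOINT: `γ x = γ' y` with `x, y ∈ B` forces `γ'⁻¹ γ = Y' Y⁻¹`
  (`Y, Y'` the matrices of `x, y`) to have all entries within `6 ε ≤ ε₀` of the identity (`inv_close`), so `γ'⁻¹ γ = 1`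
  by `IsolatedOne` (`disjoint_image_actE`);
* every translate `γ B` with `κ γ ≤ R` lies in the SLAB `W = {(p, q) : ‖q‖² ≤ 16 R, |‖p‖² − ‖q‖² − 4| ≤ 16 ε}`
  (`det (γ Y) = det Y ∈ (1 − 4ε, 1 + 4ε)` and `Σ (γ Y)² ≤ Σ γ² · Σ Y² ≤ 2 κ(γ) · 4`; `image_actE_subset_W`), whose
  volume is `≤ ofReal (32 ε) · c₂ · ofReal (16 R) · c₂` by Fubini in `(q, p)`: over each `q` the `p`-slice is an annulus
  `‖p‖² ∈ [s − 16 ε, s + 16 ε]` of area `≤ 32 ε · c₂`, `c₂ = volume (ball 0 1)` of the plane (`volume_annulus_le`,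
  `volume_W_le`);
* so `#t · volume B ≤ volume W` for every finite `t ⊆ {κ ≤ R}` (`measure_biUnion_finset`; `card_mul_volume_le`),
  `volume B = (ofReal (ε²) c₂)²` (`volume_ball_z₁`), and the count follows (`card_le_of_kappa_le`); finiteness of `{κ ≤ R}`
  is the same bound applied to arbitrarily large finite subsets (`Set.Infinite.exists_subset_card_eq`;
  `finite_setOf_kappa_le`).
Nothing here is about the real `X`, `U(W_A)(F)`, (N) or (P): the real lattice's discreteness in `∏_{v | ∞} U(W_A)(F_v)` and
the identification of its `(1,1)`-place images with subgroups of `SL(2, ℝ)` stay the dictionary (TYPING-CENSUS T7).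

Sorry-free; axioms: propext / Classical.choice / Quot.sound. §8(d): uses an L-value-free non-vanishing device: NO.
-/

namespace Summit.Ventures.HodgeRepro2.Tier7.Line3.DiscreteSubgroupCount

open MeasureTheory Metric Matrix Summit.Ventures.HodgeRepro2.Tier7.Line3.HyperbolicSize
  Summit.Ventures.HodgeRepro2.Tier7.Line3.DiscreteSubgroupPacking
open scoped MatrixGroups

noncomputable section

/-! ## 5. The slab `W` and its Lebesgue measure (Fubini over `q`, an annulus in `p`) -/

/-- the area of the unit disc of the plane (a positive finite constant; `= π`, not needed) -/
def c₂ : ENNReal := volume (ball (0 : E₂) 1)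

/-- the unit disc has positive area -/
theorem c₂_pos : 0 < c₂ := measure_ball_pos _ _ one_pos

/-- the unit disc has finite area -/
theorem c₂_ne_top : c₂ ≠ ⊤ := measure_ball_lt_top.ne

/-- the area of a disc of radius `r` is `r² c₂` -/
theorem volume_ball_E₂ (x : E₂) {r : ℝ} (hr : 0 ≤ r) : volume (ball x r) = ENNReal.ofReal (r ^ 2) * c₂ := by
  rw [Measure.addHaar_ball volume x hr, finrank_euclideanSpace_fin]; rfl

/-- the area of a closed disc of radius `r` is `r² c₂` -/
theorem volume_closedBall_E₂ (x : E₂) {r : ℝ} (hr : 0 ≤ r) :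
    volume (closedBall x r) = ENNReal.ofReal (r ^ 2) * c₂ := by
  rw [Measure.addHaar_closedBall volume x hr, finrank_euclideanSpace_fin]; rfl

/-- `‖p‖² ≤ b` gives `‖p‖ ≤ √b` -/
theorem norm_le_sqrt_of_sq_le {p : E₂} {b : ℝ} (h : ‖p‖ ^ 2 ≤ b) : ‖p‖ ≤ Real.sqrt b := by
  calc ‖p‖ = Real.sqrt (‖p‖ ^ 2) := (Real.sqrt_sq (norm_nonneg p)).symm
    _ ≤ Real.sqrt b := Real.sqrt_le_sqrt h

/-- THE ANNULUS `a ≤ ‖p‖² ≤ b` has area `≤ (b − a) · c₂` -/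
theorem volume_annulus_le (a b : ℝ) :
    volume {p : E₂ | a ≤ ‖p‖ ^ 2 ∧ ‖p‖ ^ 2 ≤ b} ≤ ENNReal.ofReal (b - a) * c₂ := by
  rcases lt_or_ge b a with hba | hab
  · have : {p : E₂ | a ≤ ‖p‖ ^ 2 ∧ ‖p‖ ^ 2 ≤ b} = ∅ := by
      ext p
      simp only [Set.mem_setOf_eq, Set.mem_empty_iff_false, iff_false, not_and, not_le]
      intro h; linarith
    rw [this, measure_empty]; exact zero_le
  rcases le_or_gt a 0 with ha | ha
  · rcases lt_or_ge b 0 with hb | hb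
    · have : {p : E₂ | a ≤ ‖p‖ ^ 2 ∧ ‖p‖ ^ 2 ≤ b} = ∅ := by
        ext p
        simp only [Set.mem_setOf_eq, Set.mem_empty_iff_false, iff_false, not_and, not_le]
        intro _; exact lt_of_lt_of_le hb (sq_nonneg _)
      rw [this, measure_empty]; exact zero_le
    calc volume {p : E₂ | a ≤ ‖p‖ ^ 2 ∧ ‖p‖ ^ 2 ≤ b} ≤ volume (closedBall (0 : E₂) (Real.sqrt b)) := by
          apply measure_mono
          intro p hp
          rw [mem_closedBall_zero_iff]
          exact norm_le_sqrt_of_sq_le hp.2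
      _ = ENNReal.ofReal b * c₂ := by rw [volume_closedBall_E₂ _ (Real.sqrt_nonneg b), Real.sq_sqrt hb]
      _ ≤ ENNReal.ofReal (b - a) * c₂ := by
          gcongr
          linarith
  · have hb : 0 ≤ b := by linarith
    have hsub : {p : E₂ | a ≤ ‖p‖ ^ 2 ∧ ‖p‖ ^ 2 ≤ b} ⊆
        closedBall (0 : E₂) (Real.sqrt b) \ ball (0 : E₂) (Real.sqrt a) := by
      intro p hp
      refine ⟨?_, ?_⟩
      · rw [mem_closedBall_zero_iff]; exact norm_le_sqrt_of_sq_le hp.2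
      · rw [mem_ball_zero_iff, not_lt]
        calc Real.sqrt a ≤ Real.sqrt (‖p‖ ^ 2) := Real.sqrt_le_sqrt hp.1
          _ = ‖p‖ := Real.sqrt_sq (norm_nonneg p)
    have hbb : ball (0 : E₂) (Real.sqrt a) ⊆ closedBall (0 : E₂) (Real.sqrt b) :=
      ball_subset_closedBall.trans (closedBall_subset_closedBall (Real.sqrt_le_sqrt hab))
    calc volume {p : E₂ | a ≤ ‖p‖ ^ 2 ∧ ‖p‖ ^ 2 ≤ b}
        ≤ volume (closedBall (0 : E₂) (Real.sqrt b) \ ball (0 : E₂) (Real.sqrt a)) := measure_mono hsub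
      _ = volume (closedBall (0 : E₂) (Real.sqrt b)) - volume (ball (0 : E₂) (Real.sqrt a)) :=
          measure_sdiff hbb measurableSet_ball.nullMeasurableSet measure_ball_lt_top.ne
      _ = ENNReal.ofReal b * c₂ - ENNReal.ofReal a * c₂ := by
          rw [volume_closedBall_E₂ _ (Real.sqrt_nonneg b), Real.sq_sqrt hb,
            volume_ball_E₂ _ (Real.sqrt_nonneg a), Real.sq_sqrt ha.le]
      _ = ENNReal.ofReal (b - a) * c₂ := by
          rw [ENNReal.ofReal_sub b ha.le, ENNReal.sub_mul (fun _ _ => c₂_ne_top)]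

/-- THE SLAB: `‖q‖² ≤ 16 R` and `|‖p‖² − ‖q‖² − 4| ≤ 16 ε` — where every translate `γ B`, `κ γ ≤ R`, lives -/
def W (R ε : ℝ) : Set E :=
  {w | ‖w.2‖ ^ 2 ≤ 16 * R ∧ 4 - 16 * ε ≤ ‖w.1‖ ^ 2 - ‖w.2‖ ^ 2 ∧ ‖w.1‖ ^ 2 - ‖w.2‖ ^ 2 ≤ 4 + 16 * ε}

/-- the slab is closed, hence measurable -/
theorem measurableSet_W (R ε : ℝ) : MeasurableSet (W R ε) := by
  have h1 : Continuous fun w : E => ‖w.1‖ ^ 2 := continuous_fst.norm.pow 2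
  have h2 : Continuous fun w : E => ‖w.2‖ ^ 2 := continuous_snd.norm.pow 2
  exact ((isClosed_le h2 continuous_const).inter
    ((isClosed_le continuous_const (h1.sub h2)).inter (isClosed_le (h1.sub h2) continuous_const))).measurableSet

/-- THE VOLUME OF THE SLAB: `≤ 32 ε c₂ · 16 R c₂` -/
theorem volume_W_le {R : ℝ} (ε : ℝ) (hR : 0 ≤ R) :
    volume (W R ε) ≤ ENNReal.ofReal (32 * ε) * c₂ * (ENNReal.ofReal (16 * R) * c₂) := by
  rw [Measure.volume_eq_prod, Measure.prod_apply_symm (measurableSet_W R ε)]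
  have hslice : ∀ q : E₂, volume ((fun p : E₂ => (p, q)) ⁻¹' W R ε) ≤
      (closedBall (0 : E₂) (Real.sqrt (16 * R))).indicator (fun _ => ENNReal.ofReal (32 * ε) * c₂) q := by
    intro q
    by_cases hq : q ∈ closedBall (0 : E₂) (Real.sqrt (16 * R))
    · rw [Set.indicator_of_mem hq]
      calc volume ((fun p : E₂ => (p, q)) ⁻¹' W R ε)
          ≤ volume {p : E₂ | ‖q‖ ^ 2 + 4 - 16 * ε ≤ ‖p‖ ^ 2 ∧ ‖p‖ ^ 2 ≤ ‖q‖ ^ 2 + 4 + 16 * ε} := by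
            apply measure_mono
            intro p hp
            simp only [Set.mem_preimage, W, Set.mem_setOf_eq] at hp
            exact ⟨by linarith [hp.2.1], by linarith [hp.2.2]⟩
        _ ≤ ENNReal.ofReal (‖q‖ ^ 2 + 4 + 16 * ε - (‖q‖ ^ 2 + 4 - 16 * ε)) * c₂ := volume_annulus_le _ _
        _ = ENNReal.ofReal (32 * ε) * c₂ := by congr 2; ring
    · rw [Set.indicator_of_notMem hq]
      have : (fun p : E₂ => (p, q)) ⁻¹' W R ε = ∅ := by
        ext p
        simp only [Set.mem_preimage, W, Set.mem_setOf_eq, Set.mem_empty_iff_false, iff_false, not_and]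
        intro h
        exact absurd (mem_closedBall_zero_iff.mpr (norm_le_sqrt_of_sq_le h)) hq
      rw [this, measure_empty]
  calc ∫⁻ q, volume ((fun p : E₂ => (p, q)) ⁻¹' W R ε) ∂volume
      ≤ ∫⁻ q, (closedBall (0 : E₂) (Real.sqrt (16 * R))).indicator
          (fun _ => ENNReal.ofReal (32 * ε) * c₂) q ∂volume := lintegral_mono hslice
    _ = ENNReal.ofReal (32 * ε) * c₂ * volume (closedBall (0 : E₂) (Real.sqrt (16 * R))) :=
        lintegral_indicator_const measurableSet_closedBall _
    _ = ENNReal.ofReal (32 * ε) * c₂ * (ENNReal.ofReal (16 * R) * c₂) := by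
        rw [volume_closedBall_E₂ _ (Real.sqrt_nonneg _), Real.sq_sqrt (by linarith)]

/-- the volume of the ball `B = ball z₁ ε` of `E` (a product of two discs) -/
theorem volume_ball_z₁ {ε : ℝ} (hε : 0 ≤ ε) :
    volume (ball z₁ ε) = ENNReal.ofReal (ε ^ 2) * c₂ * (ENNReal.ofReal (ε ^ 2) * c₂) := by
  have h : ball z₁ ε = ball z₁.1 ε ×ˢ ball z₁.2 ε := (ball_prod_same _ _ _).symm
  rw [h, Measure.volume_eq_prod, Measure.prod_prod, volume_ball_E₂ _ hε, volume_ball_E₂ _ hε]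

/-! ## 6. Packing: the translates `γ B` are disjoint and lie in the slab -/

/-- the four entry equations of `δ Y = Y'` -/
theorem entries_mul_eq {δ : SL(2, ℝ)} {Y Y' : Matrix (Fin 2) (Fin 2) ℝ}
    (h : (δ : Matrix (Fin 2) (Fin 2) ℝ) * Y = Y') :
    δ 0 0 * Y 0 0 + δ 0 1 * Y 1 0 = Y' 0 0 ∧ δ 0 0 * Y 0 1 + δ 0 1 * Y 1 1 = Y' 0 1 ∧
      δ 1 0 * Y 0 0 + δ 1 1 * Y 1 0 = Y' 1 0 ∧ δ 1 0 * Y 0 1 + δ 1 1 * Y 1 1 = Y' 1 1 := by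
  have h00 := congrFun (congrFun h 0) 0
  have h01 := congrFun (congrFun h 0) 1
  have h10 := congrFun (congrFun h 1) 0
  have h11 := congrFun (congrFun h 1) 1
  rw [Matrix.mul_apply, Fin.sum_univ_two] at h00 h01 h10 h11
  exact ⟨h00, h01, h10, h11⟩

/-- the isolation hypothesis: `1` is isolated in `Γ` at scale `ε₀` (entrywise) -/
def IsolatedOne (Γ : Subgroup SL(2, ℝ)) (ε₀ : ℝ) : Prop :=
  ∀ γ ∈ Γ, (∀ i j, |(γ : Matrix (Fin 2) (Fin 2) ℝ) i j - (1 : Matrix (Fin 2) (Fin 2) ℝ) i j| < ε₀) → γ = 1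

/-- DISJOINTNESS of the translates `γ B`, `γ' B` for `γ ≠ γ'` in `Γ`: `γ'⁻¹ γ = Y' Y⁻¹` is within `6 ε ≤ ε₀` of `1` -/
theorem disjoint_image_actE {Γ : Subgroup SL(2, ℝ)} {ε₀ : ℝ} (hdisc : IsolatedOne Γ ε₀)
    {ε : ℝ} (hε : ε ≤ 1 / 8) (h6 : 6 * ε ≤ ε₀) {γ γ' : SL(2, ℝ)} (hγ : γ ∈ Γ) (hγ' : γ' ∈ Γ)
    (hne : γ ≠ γ') : Disjoint (actE γ '' ball z₁ ε) (actE γ' '' ball z₁ ε) := by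
  rw [Set.disjoint_left]
  rintro w ⟨z, hz, rfl⟩ ⟨z', hz', hw⟩
  apply hne
  have hmem : γ'⁻¹ * γ ∈ Γ := Γ.mul_mem (Γ.inv_mem hγ') hγ
  have hz'' : actE (γ'⁻¹ * γ) z = z' := by rw [← actE_mul, ← hw, actE_inv_actE]
  have hY : (γ'⁻¹ * γ : SL(2, ℝ)) * mat (Ψ z) = mat (Ψ z') := by
    rw [← mat_actF, ← Ψ_actE, hz'']
  obtain ⟨ha, hb, hc, hd⟩ := entries_close hz
  obtain ⟨ha', hb', hc', hd'⟩ := entries_close hz'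
  obtain ⟨h1, h2, h3, h4⟩ := entries_mul_eq hY
  obtain ⟨hx, hy, hu, hv⟩ := inv_close hε ha hb hc hd ha' hb' hc' hd' h1 h2 h3 h4
  have hδ : γ'⁻¹ * γ = 1 := by
    apply hdisc _ hmem
    intro i j
    fin_cases i <;> fin_cases j
    · simpa using lt_of_lt_of_le hx h6
    · simpa using lt_of_lt_of_le hy h6
    · simpa using lt_of_lt_of_le hu h6
    · simpa using lt_of_lt_of_le hv h6
  exact (inv_mul_eq_one.mp hδ).symm

/-- CONTAINMENT: for `κ γ ≤ R` the translate `γ B` lies in the slab `W R ε` -/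
theorem image_actE_subset_W {γ : SL(2, ℝ)} {R ε : ℝ} (hε : ε ≤ 1 / 8) (hκ : κ γ ≤ R) :
    actE γ '' ball z₁ ε ⊆ W R ε := by
  rintro w ⟨z, hz, rfl⟩
  obtain ⟨ha, hb, hc, hd⟩ := entries_close hz
  have hdet := det_mat_Ψ (actE γ z)
  have hsum := sum_sq_mat_Ψ (actE γ z)
  rw [Ψ_actE, mat_actF] at hdet hsum
  rw [Matrix.det_mul, γ.det_coe, one_mul, Matrix.det_fin_two] at hdet
  obtain ⟨hd1, -⟩ := det_close hε ha hb hc hd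
  simp only [Matrix.mul_apply, Fin.sum_univ_two] at hsum
  have hcs := sum_sq_mul_le (γ 0 0) (γ 0 1) (γ 1 0) (γ 1 1) (mat (Ψ z) 0 0) (mat (Ψ z) 0 1)
    (mat (Ψ z) 1 0) (mat (Ψ z) 1 1)
  have hγ : γ 0 0 ^ 2 + γ 0 1 ^ 2 + γ 1 0 ^ 2 + γ 1 1 ^ 2 ≤ 2 * R := by
    have := κ_eq γ; linarith
  have hY := sum_sq_le_four hε ha hb hc hd
  have hnn : 0 ≤ γ 0 0 ^ 2 + γ 0 1 ^ 2 + γ 1 0 ^ 2 + γ 1 1 ^ 2 := by positivity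
  have hprod : (γ 0 0 ^ 2 + γ 0 1 ^ 2 + γ 1 0 ^ 2 + γ 1 1 ^ 2) *
      (mat (Ψ z) 0 0 ^ 2 + mat (Ψ z) 0 1 ^ 2 + mat (Ψ z) 1 0 ^ 2 + mat (Ψ z) 1 1 ^ 2) ≤ 2 * R * 4 :=
    mul_le_mul hγ hY (by positivity) (by linarith)
  simp only [W, Set.mem_setOf_eq]
  refine ⟨?_, ?_, ?_⟩
  · nlinarith [sq_nonneg ‖(actE γ z).1‖]
  · rw [abs_lt] at hd1; linarith
  · rw [abs_lt] at hd1; linarith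

/-! ## 7. THE COUNT -/

/-- `#t · volume B ≤ volume W` for every finite set `t` of elements of `Γ` with `κ ≤ R` -/
theorem card_mul_volume_le {Γ : Subgroup SL(2, ℝ)} {ε₀ : ℝ} (hdisc : IsolatedOne Γ ε₀)
    {ε : ℝ} (hε : ε ≤ 1 / 8) (h6 : 6 * ε ≤ ε₀) {R : ℝ} (t : Finset Γ)
    (ht : ∀ γ ∈ t, κ (γ : SL(2, ℝ)) ≤ R) :
    (t.card : ENNReal) * volume (ball z₁ ε) ≤ volume (W R ε) := by
  have hdisj : (↑t : Set Γ).PairwiseDisjoint fun γ : Γ => actE (γ : SL(2, ℝ)) '' ball z₁ ε := by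
    intro γ _ γ' _ hne
    exact disjoint_image_actE hdisc hε h6 γ.2 γ'.2 fun h => hne (Subtype.ext h)
  have hmeas : ∀ γ ∈ t, MeasurableSet (actE (γ : SL(2, ℝ)) '' ball z₁ ε) := fun γ _ =>
    measurableSet_image_actE _ measurableSet_ball
  calc (t.card : ENNReal) * volume (ball z₁ ε)
      = ∑ γ ∈ t, volume (actE (γ : SL(2, ℝ)) '' ball z₁ ε) := by
        simp only [volume_image_actE]
        rw [Finset.sum_const, nsmul_eq_mul]
    _ = volume (⋃ γ ∈ t, actE (γ : SL(2, ℝ)) '' ball z₁ ε) := (measure_biUnion_finset hdisj hmeas).symm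
    _ ≤ volume (W R ε) := by
        apply measure_mono
        apply Set.iUnion₂_subset
        intro γ hγ
        exact image_actE_subset_W hε (ht γ hγ)

/-- THE SHARP COUNT, explicit: `#t ≤ 512 R / ε³` for every finite `t ⊆ {γ ∈ Γ : κ γ ≤ R}` -/
theorem card_le_of_kappa_le {Γ : Subgroup SL(2, ℝ)} {ε₀ : ℝ} (hdisc : IsolatedOne Γ ε₀)
    {ε : ℝ} (hε0 : 0 < ε) (hε : ε ≤ 1 / 8) (h6 : 6 * ε ≤ ε₀) {R : ℝ} (hR : 0 ≤ R) (t : Finset Γ)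
    (ht : ∀ γ ∈ t, κ (γ : SL(2, ℝ)) ≤ R) : (t.card : ℝ) ≤ 512 * R / ε ^ 3 := by
  have h := card_mul_volume_le hdisc hε h6 t ht
  have h2 := volume_W_le ε hR
  rw [volume_ball_z₁ hε0.le] at h
  have h3 := h.trans h2
  have h4 : (t.card : ENNReal) * ENNReal.ofReal (ε ^ 2) * ENNReal.ofReal (ε ^ 2) ≤
      ENNReal.ofReal (32 * ε) * ENNReal.ofReal (16 * R) := by
    have hc : c₂ * c₂ ≠ 0 := mul_ne_zero c₂_pos.ne' c₂_pos.ne'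
    have hc' : c₂ * c₂ ≠ ⊤ := ENNReal.mul_ne_top c₂_ne_top c₂_ne_top
    rw [← ENNReal.mul_le_mul_iff_right hc hc']
    calc c₂ * c₂ * ((t.card : ENNReal) * ENNReal.ofReal (ε ^ 2) * ENNReal.ofReal (ε ^ 2))
        = (t.card : ENNReal) * (ENNReal.ofReal (ε ^ 2) * c₂ * (ENNReal.ofReal (ε ^ 2) * c₂)) := by ring
      _ ≤ ENNReal.ofReal (32 * ε) * c₂ * (ENNReal.ofReal (16 * R) * c₂) := h3
      _ = c₂ * c₂ * (ENNReal.ofReal (32 * ε) * ENNReal.ofReal (16 * R)) := by ring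
  rw [← ENNReal.ofReal_natCast, ← ENNReal.ofReal_mul (by positivity), ← ENNReal.ofReal_mul (by positivity),
    ← ENNReal.ofReal_mul (by positivity), ENNReal.ofReal_le_ofReal_iff (by positivity)] at h4
  rw [le_div_iff₀ (by positivity)]
  have h5 : ε * ((t.card : ℝ) * ε ^ 3) ≤ ε * (512 * R) := by nlinarith [h4]
  exact le_of_mul_le_mul_left h5 hε0

/-- FINITENESS of `{γ ∈ Γ : κ γ ≤ R}` -/
theorem finite_setOf_kappa_le {Γ : Subgroup SL(2, ℝ)} {ε₀ : ℝ} (hdisc : IsolatedOne Γ ε₀)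
    {ε : ℝ} (hε0 : 0 < ε) (hε : ε ≤ 1 / 8) (h6 : 6 * ε ≤ ε₀) {R : ℝ} (hR : 0 ≤ R) :
    {γ : Γ | κ (γ : SL(2, ℝ)) ≤ R}.Finite := by
  by_contra hinf
  obtain ⟨t, hts, hcard⟩ := Set.Infinite.exists_subset_card_eq hinf (⌊512 * R / ε ^ 3⌋₊ + 1)
  have h := card_le_of_kappa_le hdisc hε0 hε h6 hR t fun γ hγ => hts hγ
  rw [hcard] at h
  have h2 := Nat.lt_floor_add_one (512 * R / ε ^ 3)
  push_cast at h
  linarith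

/-- **THE SHARP `κ`-COUNT OF EVERY DISCRETE SUBGROUP OF `SL(2, ℝ)`** — exactly the `hcount` hypothesis of
`HyperbolicSize.summable_norm_kernel_SL2` / `continuous_kernelSum_SL2` with `β = 1`: for `Γ ≤ SL(2, ℝ)` with `1`
isolated at scale `ε₀`, `∃ C', ∀ R ≥ 0, #{γ ∈ Γ : κ γ ≤ R} ≤ C' (1 + R)^1` (`C' = 512 / ε³`, `ε = min (1/8) (ε₀/8)`). -/
theorem count_of_discrete (Γ : Subgroup SL(2, ℝ)) {ε₀ : ℝ} (hε₀ : 0 < ε₀) (hdisc : IsolatedOne Γ ε₀) :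
    ∃ C' : ℝ, ∀ R : ℝ, 0 ≤ R → ∃ t : Finset Γ,
      (∀ γ : Γ, κ (γ : SL(2, ℝ)) ≤ R → γ ∈ t) ∧ (t.card : ℝ) ≤ C' * (1 + R) ^ (1 : ℝ) := by
  set ε : ℝ := min (1 / 8) (ε₀ / 8) with hεdef
  have hε0 : 0 < ε := lt_min (by norm_num) (by linarith)
  have hε1 : ε ≤ 1 / 8 := min_le_left _ _
  have h6 : 6 * ε ≤ ε₀ := by have := min_le_right (1 / 8 : ℝ) (ε₀ / 8); linarith
  refine ⟨512 / ε ^ 3, fun R hR => ?_⟩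
  have hfin := finite_setOf_kappa_le hdisc hε0 hε1 h6 hR
  refine ⟨hfin.toFinset, fun γ hγ => hfin.mem_toFinset.mpr hγ, ?_⟩
  have h := card_le_of_kappa_le hdisc hε0 hε1 h6 hR hfin.toFinset fun γ hγ => hfin.mem_toFinset.mp hγ
  rw [Real.rpow_one]
  calc (hfin.toFinset.card : ℝ) ≤ 512 * R / ε ^ 3 := h
    _ = 512 / ε ^ 3 * R := by ring
    _ ≤ 512 / ε ^ 3 * (1 + R) := by gcongr; linarith

/-! ## 8. The Poincaré series of EVERY discrete subgroup of `SL(2, ℝ)` converges absolutely and is continuous -/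

variable (f : SL(2, ℝ) → ℂ)

/-- absolute convergence of the Poincaré series of a discrete `Γ ≤ SL(2, ℝ)` for every decay exponent `α > 1` -/
theorem summable_norm_kernel_discrete (Γ : Subgroup SL(2, ℝ)) {ε₀ : ℝ} (hε₀ : 0 < ε₀)
    (hdisc : IsolatedOne Γ ε₀) {α : ℝ} (hα : 1 < α) {C : ℝ}
    (hf : ∀ g, ‖f g‖ ≤ C * (1 + κ g) ^ (-α)) (x y : SL(2, ℝ)) :
    Summable fun γ : Γ => ‖f (x⁻¹ * (γ : SL(2, ℝ)) * y)‖ := by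
  obtain ⟨C', hC'⟩ := count_of_discrete Γ hε₀ hdisc
  exact summable_norm_kernel_SL2 (fun γ : Γ => (γ : SL(2, ℝ))) f (β := 1) zero_le_one hα hC' hf x y

/-- **THE POINCARÉ-SERIES KERNEL OF EVERY DISCRETE SUBGROUP OF `SL(2, ℝ)` IS CONTINUOUS** for every `α > 1`
(weight `3`: `α = 3/2`) — the `SL(2, ℤ)`-specific `ModularGroupCount.continuous_kernelSum_SL2Z'` for ANY discrete `Γ`. -/
theorem continuous_kernelSum_discrete (hfc : Continuous f) (Γ : Subgroup SL(2, ℝ)) {ε₀ : ℝ} (hε₀ : 0 < ε₀)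
    (hdisc : IsolatedOne Γ ε₀) {α : ℝ} (hα : 1 < α) {C : ℝ}
    (hf : ∀ g, ‖f g‖ ≤ C * (1 + κ g) ^ (-α)) :
    Continuous (fun p : SL(2, ℝ) × SL(2, ℝ) =>
      PoincareKernel.kernelSum (fun γ : Γ => (γ : SL(2, ℝ))) f p.1 p.2) := by
  obtain ⟨C', hC'⟩ := count_of_discrete Γ hε₀ hdisc
  exact continuous_kernelSum_SL2 (fun γ : Γ => (γ : SL(2, ℝ))) f hfc (β := 1) zero_le_one hα hC' hf

/-! ## 9. The instance `SL(2, ℤ)`: `1` is isolated at scale `ε₀ = 1` -/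

/-- the image of `SL(2, ℤ)` in `SL(2, ℝ)` -/
def SL2Z : Subgroup SL(2, ℝ) := (Matrix.SpecialLinearGroup.map (Int.castRingHom ℝ)).range

/-- an integer within distance `< 1` of another integer equals it -/
theorem Int.eq_of_abs_cast_sub_lt_one {m n : ℤ} (h : |(m : ℝ) - (n : ℝ)| < 1) : m = n := by
  rw [← Int.cast_sub, ← Int.cast_abs] at h
  have : |m - n| < 1 := by exact_mod_cast h
  rw [Int.abs_lt_one_iff] at this
  exact sub_eq_zero.mp this

/-- `1` is isolated in `SL(2, ℤ)` at scale `1` -/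
theorem isolated_one_SL2Z : IsolatedOne SL2Z 1 := by
  rintro γ ⟨g, rfl⟩ h
  have hg : g = 1 := by
    ext i j
    have hij := h i j
    rw [Matrix.SpecialLinearGroup.map_apply_coe, RingHom.mapMatrix_apply, Matrix.map_apply,
      eq_intCast] at hij
    rw [Matrix.SpecialLinearGroup.coe_one, Matrix.one_apply]
    rw [Matrix.one_apply] at hij
    split_ifs at hij ⊢ with hh
    · exact Int.eq_of_abs_cast_sub_lt_one (by simpa using hij)
    · exact Int.eq_of_abs_cast_sub_lt_one (by simpa using hij)
  rw [hg, map_one]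

/-- the count for `SL(2, ℤ)` as the instance `ε₀ = 1` of `count_of_discrete` -/
theorem count_SL2Z_range : ∃ C' : ℝ, ∀ R : ℝ, 0 ≤ R → ∃ t : Finset SL2Z,
    (∀ γ : SL2Z, κ (γ : SL(2, ℝ)) ≤ R → γ ∈ t) ∧ (t.card : ℝ) ≤ C' * (1 + R) ^ (1 : ℝ) :=
  count_of_discrete SL2Z one_pos isolated_one_SL2Z

end

end Summit.Ventures.HodgeRepro2.Tier7.Line3.DiscreteSubgroupCount
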